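import Mathlib
import Summits.MatrixMultiplication.MatrixMultiplication.Theses.HyperbolicRankMethods

/-!
# Border soundness of sub-additive Gårding-rank measures

Route `HyperbolicRankMethods`, item `stmt-MatrixMultiplication-10091` (`HypBorderSoundness`).

For `h ∈ ℝ[x₁, …, x_N]` homogeneous of degree `d` with `h(e) ≠ 0` write `p_w(t) = h(w + t e)`
(in Lean `MvPolynomial.aeval (fun i => C (w i) + C (e i) * X) h`) and
`Rank_h(w) = d − ord_{t=0} p_w`. If `Rank_h` is sub-additive on `ℝ^N` and `Rank_h ∘ Φ ≤ k` on
triads for a real-linear `Φ`, then `Rank_h(Φ t) ≤ k · bR(t)` for Bläser's `K[ε]`-border rank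
`algBorderRank` over `ℂ` (Bläser 2013, Def. 6.1).

Proof (no hyperbolicity is needed). The coefficient of `t^d` in `p_w` is `h(e) ≠ 0`, and
`p_0 = h(e) t^d`, so `Rank_h(0) = 0` and, by sub-additivity, the image under `Φ` of a sum of `r`
triads has `Rank_h ≤ k r`. An order-`h₀` approximate decomposition with `r = bR(t)` triads has
entries `X^{h₀} Q_{abc}` with `Q_{abc}(0) = t_{abc}`; for `s ≠ 0` the tensor `(Q_{abc}(s))_{abc}`
is a sum of `r` triads, and `s ↦ (Q_{abc}(s))` is continuous with value `t` at `s = 0`. The set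
`{x | coeff_i p_{Φ x} = 0 for all i < d − k r}` is closed (each coefficient of `p_w` is a
polynomial in `w`, and `Φ` is continuous), contains these tensors for `s ≠ 0`, hence contains
`t`; since `p_{Φ t} ≠ 0` this says `Rank_h(Φ t) ≤ k r`.
-/

namespace Summit.MatrixMultiplication.MatrixMultiplication.Theorems

open scoped BigOperators Polynomial Topology
open Filter Literature.Computability.AlgebraicComplexity

/-- The coefficient of `t^{|α|}` in `∏ᵢ (wᵢ + eᵢ t)^{αᵢ}` is `∏ᵢ eᵢ^{αᵢ}`. -/
theorem hypBorder_coeff_prod_linear_pow {N : ℕ} (w e : Fin N → ℝ) (α : Fin N → ℕ) :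
    (∏ i, (Polynomial.C (w i) + Polynomial.C (e i) * Polynomial.X) ^ (α i)).coeff (∑ i, α i) =
      ∏ i, e i ^ α i := by
  have h1 : (∏ i, (Polynomial.C (w i) + Polynomial.C (e i) * Polynomial.X) ^ (α i)) =
      ∏ x ∈ Finset.univ.sigma (fun i => Finset.range (α i)),
        (Polynomial.C (w x.1) + Polynomial.C (e x.1) * Polynomial.X) := by
    rw [Finset.prod_sigma]
    simp only [Finset.prod_const, Finset.card_range]
  have h2 : ∑ i, α i = (Finset.univ.sigma (fun i => Finset.range (α i))).card * 1 := by
    rw [Finset.card_sigma, mul_one]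
    simp only [Finset.card_range]
  rw [h1, h2, Polynomial.coeff_prod_of_natDegree_le]
  · rw [Finset.prod_sigma]
    simp [Finset.prod_const, Finset.card_range, Polynomial.coeff_C]
  · intro x _
    calc (Polynomial.C (w x.1) + Polynomial.C (e x.1) * Polynomial.X).natDegree
        = (Polynomial.C (e x.1) * Polynomial.X + Polynomial.C (w x.1)).natDegree := by
          rw [add_comm]
      _ ≤ 1 := Polynomial.natDegree_linear_le

/-- On the support of a homogeneous polynomial of degree `d` every exponent vector has total
degree `d`. -/
theorem hypBorder_sum_eq_of_mem_support {N d : ℕ} {h : MvPolynomial (Fin N) ℝ}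
    (hh : h.IsHomogeneous d) {α : Fin N →₀ ℕ} (hα : α ∈ h.support) : ∑ i, α i = d := by
  rw [← Finsupp.degree_eq_sum]
  by_contra hne
  exact (MvPolynomial.mem_support_iff.mp hα) (hh.coeff_eq_zero hne)

/-- The coefficient of `t^d` in `h(w + t e)` is `h(e)` for `h` homogeneous of degree `d`. -/
theorem hypBorder_coeff_top {N d : ℕ} {h : MvPolynomial (Fin N) ℝ} (hh : h.IsHomogeneous d)
    (e w : Fin N → ℝ) :
    (MvPolynomial.aeval (fun i => Polynomial.C (w i) + Polynomial.C (e i) * Polynomial.X)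
        h).coeff d = MvPolynomial.eval e h := by
  rw [MvPolynomial.aeval_def, MvPolynomial.eval₂_eq', MvPolynomial.eval_eq',
    Polynomial.finsetSum_coeff]
  refine Finset.sum_congr rfl fun α hα => ?_
  rw [Polynomial.algebraMap_eq, Polynomial.coeff_C_mul, ← hypBorder_sum_eq_of_mem_support hh hα,
    hypBorder_coeff_prod_linear_pow]

/-- `h(t e) = h(e) t^d` for `h` homogeneous of degree `d`. -/
theorem hypBorder_line_zero {N d : ℕ} {h : MvPolynomial (Fin N) ℝ} (hh : h.IsHomogeneous d)
    (e : Fin N → ℝ) :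
    MvPolynomial.aeval (fun i => Polynomial.C ((0 : Fin N → ℝ) i) + Polynomial.C (e i) *
        Polynomial.X) h = Polynomial.C (MvPolynomial.eval e h) * Polynomial.X ^ d := by
  simp only [Pi.zero_apply, map_zero, zero_add]
  rw [MvPolynomial.aeval_def, MvPolynomial.eval₂_eq', MvPolynomial.eval_eq', map_sum,
    Finset.sum_mul]
  refine Finset.sum_congr rfl fun α hα => ?_
  rw [Polynomial.algebraMap_eq, ← hypBorder_sum_eq_of_mem_support hh hα]
  simp only [mul_pow, Finset.prod_mul_distrib, Finset.prod_pow_eq_pow_sum, map_mul, map_prod,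
    map_pow]
  ring

/-- `Rank_h(0) = 0`: `ord_{t=0} h(t e) = d` when `h(e) ≠ 0`. -/
theorem hypBorder_rank_zero {N d : ℕ} {h : MvPolynomial (Fin N) ℝ} (hh : h.IsHomogeneous d)
    {e : Fin N → ℝ} (he : MvPolynomial.eval e h ≠ 0) :
    d - (MvPolynomial.aeval (fun i => Polynomial.C ((0 : Fin N → ℝ) i) + Polynomial.C (e i) *
        Polynomial.X) h).natTrailingDegree = 0 := by
  rw [hypBorder_line_zero hh e, Polynomial.C_mul_X_pow_eq_monomial,
    Polynomial.natTrailingDegree_monomial he, Nat.sub_self]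

/-- `h(w + t e)` is a non-zero polynomial in `t` (its `t^d`-coefficient is `h(e) ≠ 0`). -/
theorem hypBorder_line_ne_zero {N d : ℕ} {h : MvPolynomial (Fin N) ℝ} (hh : h.IsHomogeneous d)
    {e : Fin N → ℝ} (he : MvPolynomial.eval e h ≠ 0) (w : Fin N → ℝ) :
    MvPolynomial.aeval (fun i => Polynomial.C (w i) + Polynomial.C (e i) * Polynomial.X) h ≠
      0 := by
  intro H
  apply he
  rw [← hypBorder_coeff_top hh e w, H, Polynomial.coeff_zero]

/-- Each coefficient of `h(w + t e)` is a continuous (indeed polynomial) function of `w`. -/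
theorem hypBorder_continuous_coeff {N : ℕ} (h : MvPolynomial (Fin N) ℝ) (e : Fin N → ℝ)
    (i : ℕ) :
    Continuous fun w : Fin N → ℝ =>
      (MvPolynomial.aeval (fun j => Polynomial.C (w j) + Polynomial.C (e j) * Polynomial.X)
        h).coeff i := by
  set P : Polynomial (MvPolynomial (Fin N) ℝ) := MvPolynomial.aeval
    (fun j => Polynomial.C (MvPolynomial.X j) + Polynomial.C (MvPolynomial.C (e j)) *
      Polynomial.X) h with hP
  have key : ∀ w : Fin N → ℝ,
      MvPolynomial.aeval (fun j => Polynomial.C (w j) + Polynomial.C (e j) * Polynomial.X) h =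
        P.map (MvPolynomial.eval w) := by
    intro w
    have hom : (MvPolynomial.aeval (R := ℝ)
          (fun j => Polynomial.C (w j) + Polynomial.C (e j) * Polynomial.X)).toRingHom =
        (Polynomial.mapRingHom (MvPolynomial.eval w)).comp
          (MvPolynomial.aeval (R := ℝ) (fun j => Polynomial.C (MvPolynomial.X j) +
            Polynomial.C (MvPolynomial.C (e j)) * Polynomial.X)).toRingHom := by
      refine MvPolynomial.ringHom_ext (fun a => ?_) (fun j => ?_)
      · simp [Polynomial.algebraMap_apply, MvPolynomial.algebraMap_eq]
      · simp
    simpa [hP] using RingHom.congr_fun hom h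
  simp_rw [key, Polynomial.coeff_map]
  exact MvPolynomial.continuous_eval _

/-- Sub-additivity and the triad bound give `Rank_h(Φ(∑_{ρ ∈ s} triad_ρ)) ≤ k · |s|`. -/
theorem hypBorder_rank_sum_triad {ι κ μ : Type} {N d k : ℕ} {h : MvPolynomial (Fin N) ℝ}
    (hh : h.IsHomogeneous d) {e : Fin N → ℝ} (he : MvPolynomial.eval e h ≠ 0)
    (Φ : (ι → κ → μ → ℂ) →ₗ[ℝ] (Fin N → ℝ))
    (hsub : ∀ u v : Fin N → ℝ, (d - (MvPolynomial.aeval (fun i => Polynomial.C ((u + v) i) +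
      Polynomial.C (e i) * Polynomial.X) h).natTrailingDegree) ≤
      (d - (MvPolynomial.aeval (fun i => Polynomial.C (u i) + Polynomial.C (e i) * Polynomial.X)
        h).natTrailingDegree) +
      (d - (MvPolynomial.aeval (fun i => Polynomial.C (v i) + Polynomial.C (e i) * Polynomial.X)
        h).natTrailingDegree))
    (hone : ∀ (w : ι → ℂ) (u : κ → ℂ) (v : μ → ℂ), (d - (MvPolynomial.aeval (fun i =>
      Polynomial.C ((Φ (triad w u v)) i) + Polynomial.C (e i) * Polynomial.X)
        h).natTrailingDegree) ≤ k)
    {σ : Type*} (s : Finset σ) (W : σ → ι → ℂ) (U : σ → κ → ℂ) (V : σ → μ → ℂ) :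
    d - (MvPolynomial.aeval (fun i => Polynomial.C ((Φ (∑ ρ ∈ s, triad (W ρ) (U ρ) (V ρ))) i) +
      Polynomial.C (e i) * Polynomial.X) h).natTrailingDegree ≤ k * s.card := by
  classical
  induction s using Finset.induction_on with
  | empty =>
    rw [Finset.sum_empty, map_zero, Finset.card_empty, mul_zero]
    exact (hypBorder_rank_zero hh he).le
  | insert a s ha ih =>
    rw [Finset.sum_insert ha, map_add, Finset.card_insert_of_notMem ha, mul_add_one,
      add_comm (k * s.card) k]
    exact (hsub _ _).trans (add_le_add (hone _ _ _) ih)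

/-- **Border soundness** (`HypBorderSoundness`, item stmt-MatrixMultiplication-10091): a
sub-additive Gårding-rank measure `w ↦ d − ord_{t=0} h(w + t e)` (`h` homogeneous of degree `d`,
`h(e) ≠ 0`) that is at most `k` on `Φ`(triads) satisfies `Rank_h(Φ t) ≤ k · bR(t)` for Bläser's
`K[ε]`-border rank over `ℂ`. -/
theorem hypBorderSoundness_proof :
    Summit.MatrixMultiplication.MatrixMultiplication.Theses.HyperbolicRankMethods.HypBorderSoundness := by
  intro ι κ μ _ _ _ N d k h e Φ hh he hsub hone t
  classical
  -- the border rank is attained at some order `h₀`, by a decomposition with `r = bR(t)` triads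
  obtain ⟨h₀, hh₀⟩ : ∃ h₀, algBorderRank t = approxRank h₀ t := by
    obtain ⟨h₀, hh₀⟩ := Nat.sInf_mem (Set.range_nonempty fun h₀ => approxRank h₀ t)
    exact ⟨h₀, hh₀.symm⟩
  rw [hh₀]
  set r := approxRank h₀ t with hr
  obtain ⟨u, v, w, huvw⟩ : ∃ (u : Fin r → ι → ℂ[X]) (v : Fin r → κ → ℂ[X])
      (w : Fin r → μ → ℂ[X]), IsApproxDecomposition h₀ t u v w := by
    obtain ⟨r', u, v, w, H⟩ := exists_isApproxDecomposition h₀ t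
    exact Nat.sInf_mem (s := {r : ℕ | ∃ (u : Fin r → ι → ℂ[X]) (v : Fin r → κ → ℂ[X])
      (w : Fin r → μ → ℂ[X]), IsApproxDecomposition h₀ t u v w}) ⟨r', u, v, w, H⟩
  -- factor the entries: `∑_ρ u_ρ(a) v_ρ(b) w_ρ(c) = ε^{h₀} Q_{abc}` with `Q_{abc}(0) = t_{abc}`
  have hQ : ∀ a b c, ∃ Q : ℂ[X], (∑ ρ, u ρ a * v ρ b * w ρ c) = Polynomial.X ^ h₀ * Q ∧
      Q.coeff 0 = t a b c := by
    intro a b c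
    obtain ⟨Q, hQ⟩ : Polynomial.X ^ h₀ ∣ ∑ ρ, u ρ a * v ρ b * w ρ c :=
      Polynomial.X_pow_dvd_iff.mpr fun j hj => by
        have := huvw a b c j hj.le
        rwa [if_neg hj.ne] at this
    refine ⟨Q, hQ, ?_⟩
    have h1 := huvw a b c h₀ le_rfl
    have h2 : (Polynomial.X ^ h₀ * Q).coeff (0 + h₀) = Q.coeff 0 :=
      Polynomial.coeff_X_pow_mul Q h₀ 0
    rw [zero_add, ← hQ, h1, if_pos rfl] at h2
    exact h2.symm
  choose Q hQ1 hQ2 using hQ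
  -- the curve `s ↦ (Q_{abc}(s))_{abc}`: continuous, equal to `t` at `0`, a sum of `r` triads
  -- for `s ≠ 0`
  set γ : ℂ → (ι → κ → μ → ℂ) := fun s a b c => (Q a b c).eval s with hγ
  have hγc : Continuous γ :=
    continuous_pi fun a => continuous_pi fun b => continuous_pi fun c => (Q a b c).continuous
  have hγ0 : γ 0 = t := by
    funext a b c
    show (Q a b c).eval 0 = t a b c
    rw [← Polynomial.coeff_zero_eq_eval_zero, hQ2]
  have hγs : ∀ s : ℂ, s ≠ 0 → γ s = ∑ ρ, triad (fun a => (s ^ h₀)⁻¹ * (u ρ a).eval s)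
      (fun b => (v ρ b).eval s) (fun c => (w ρ c).eval s) := by
    intro s hs
    funext a b c
    have h1 : (∑ ρ, u ρ a * v ρ b * w ρ c).eval s = s ^ h₀ * (Q a b c).eval s := by
      rw [hQ1 a b c, Polynomial.eval_mul, Polynomial.eval_pow, Polynomial.eval_X]
    rw [Polynomial.eval_finsetSum] at h1
    simp only [Polynomial.eval_mul] at h1
    simp only [hγ, Finset.sum_apply, triad_apply]
    calc (Q a b c).eval s = (s ^ h₀)⁻¹ * (s ^ h₀ * (Q a b c).eval s) := by
          rw [← mul_assoc, inv_mul_cancel₀ (pow_ne_zero _ hs), one_mul]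
      _ = (s ^ h₀)⁻¹ * ∑ ρ, (u ρ a).eval s * (v ρ b).eval s * (w ρ c).eval s := by rw [h1]
      _ = ∑ ρ, (s ^ h₀)⁻¹ * (u ρ a).eval s * (v ρ b).eval s * (w ρ c).eval s := by
          rw [Finset.mul_sum]
          refine Finset.sum_congr rfl fun ρ _ => ?_
          ring
  -- the closed sublevel set `{x | Rank_h(Φ x) ≤ k r}` in coefficient form
  set S : Set (ι → κ → μ → ℂ) := {x | ∀ i < d - k * r,
    (MvPolynomial.aeval (fun j => Polynomial.C ((Φ x) j) + Polynomial.C (e j) * Polynomial.X)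
      h).coeff i = 0} with hS
  have hSc : IsClosed S := by
    have hΦ : Continuous Φ := Φ.continuous_of_finiteDimensional
    simp only [hS, Set.setOf_forall]
    exact isClosed_iInter fun i => isClosed_iInter fun _ =>
      isClosed_eq ((hypBorder_continuous_coeff h e i).comp hΦ) continuous_const
  have hmem : ∀ s : ℂ, s ≠ 0 → γ s ∈ S := by
    intro s hs i hi
    have hle := hypBorder_rank_sum_triad hh he Φ hsub hone Finset.univ
      (fun ρ a => (s ^ h₀)⁻¹ * (u ρ a).eval s) (fun ρ b => (v ρ b).eval s)
      (fun ρ c => (w ρ c).eval s)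
    rw [Finset.card_univ, Fintype.card_fin, ← hγs s hs] at hle
    exact Polynomial.coeff_eq_zero_of_lt_natTrailingDegree (by omega)
  -- pass to the limit `s → 0`
  have ht : t ∈ S := by
    rw [← hγ0]
    exact hSc.mem_of_tendsto ((hγc.tendsto 0).mono_left nhdsWithin_le_nhds)
      (eventually_nhdsWithin_of_forall (s := {(0 : ℂ)}ᶜ) fun s hs =>
        hmem s (Set.mem_compl_singleton_iff.mp hs))
  have hne := hypBorder_line_ne_zero hh he (Φ t)
  have hge := Polynomial.le_natTrailingDegree hne fun m hm => ht m hm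
  omega

end Summit.MatrixMultiplication.MatrixMultiplication.Theorems
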